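/-
Copyright (c) 2026 the pub-hodgecm-mathlib formalisation cell (harness21).  Prover seat hodgecm-mathlib-F0P2-p01 (g15): road «S3-ram» (LEAD F0P3a-plan (g12); architect
A-p16 (g31); junction pen F0P3a-p01 (g17), J-PACK v2 03ef5f1f; owner F0P3a-p06 (g15)), organ A′ (ii): FILE M (sequel), the kernel TEST of ROW-E ∕ ROW-O; 2026-09-02.
-/
import Literature.NumberTheory.Automorphic.UnitaryLatticeTreeNilpotentVertexKernelRamified   -- ★∕filed M (this seat): the even∕odd SHAPES; brings ★ L, K, J, I, H, G′, G, F, E, D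
import HarnessLib

/-!
# The lattice graph of a hermitian space — THE KERNEL TEST OF A RESIDUALLY NILPOTENT FIXED VERTEX (tame-ramified place): `Yy ≡ 0 ⇒ ȳ ∈ ⟨ē₀⟩`, and the first column of
# `k⁻¹Yk` vanishes residually iff `k·N₁ = N₁` (Bruhat–Tits 1972 §10; Tits 1979 §3.5; Kottwitz 1986 §3)

Topic `NumberTheory/Automorphic`; namespace `Literature.NumberTheory.Automorphic.UnitaryLatticeTree`.  THEOREMS ONLY (no definition, no instance, no notation, no named fact,
no `sorry`); kernel lane `--supports stmt-HodgeConjecture-24833`.  Cell `pub/hodgecm-mathlib` (D-0151), crux H413; road «S3-ram» (Literature seeding, count-neutral), organ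
A′ (ii) of the P-1-ram skeleton (architect A-p16 (g31)); junction J-PACK v2 rows ROW-E ∕ ROW-O (F0P3a-p01 (g17)), LABEL side, sequel to ★ M (the SHAPES of the residual matrix
`Y = γ − 1` in the inward-adapted unitary frame: even `Ȳ = γ′(E₁₂ − E₀₁)`, odd `Ȳ = γ′(E₀₁ + E₁₂) + s·E₀₂`, both with the pivots `|Y₁₂| = |Y₀₁| = |ϖ|^d` and every entry off
`{(0,1),(1,2),(0,2)}` of size `≤ |ϖ|^{d+1}`).  THIS FILE: the KERNEL TEST — an integral `y` with `Yy ≡ 0 (ϖ^{d+1})` has `|y₁|, |y₂| < 1` (`ȳ ∈ ⟨ē₀⟩ = ker Ȳ`), and for `k ∈ K₀` (the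
frame change to the neighbour `(uκ₀k)·N₁`) **the first column of `k⁻¹Yk` is `≡ 0 (ϖ^{d+1})` iff `|k₂₀| < 1`** iff `k·N₁ = N₁` (★ K `mapGL_N₁_eq_iff_v_apply_two_zero_lt_one`):
the only neighbour whose line is a kernel line of `Ȳ` is the INWARD one, so every OUTWARD null line is «not kernel» and ★ J `not_lev_and_not_lev₂_childLatt_of_cube_le` gives
its children the label `(d − 1, rank 2)` — the rows `E_m → q²·O_{m−1}` and `O_m → q·E_m` (CERT smoke v1.3 §6, A-p16 (g31)).  J₀-MODEL, DATUM `hvσ hϖ`.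

* §0 `v_mulVec_apply_le_of_forall_le`, `mul_apply_zero_eq_mulVec`, `v_le_of_lt_one`.
* §1 **`v_apply_lt_one_of_forall_v_mulVec_le`** (kernel test), **`forall_v_conj_apply_zero_le_succ_iff`** (`↔ |k₂₀| < 1`).

HONEST LABEL: HC_CM is proved only modulo the 2 remaining named inputs (hLiu418 24832, h413 24833) until rung 0 closes; nothing printed is asserted here (elementary algebra
over a valuation ring); «S3-ram» has no books consequence.

## References
* [BruhatTits1972] F. Bruhat, J. Tits, *Groupes réductifs sur un corps local I*, Publ. Math. IHÉS 41 (1972), §10 (lattice models; vertex stabilisers and their filtrations).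
* [Tits1979] J. Tits, *Reductive groups over local fields*, PSPM 33.1 (1979), §3.5 (congruence filtration; reduction mod `𝔭`).
* [Kottwitz1986] R. E. Kottwitz, *Base change for unit elements of Hecke algebras*, Compositio Math. 60 (1986), §3 (levels of fixed lattices; shell recursion).
* [Serre1980Trees] J.-P. Serre, *Trees* (1980), Ch. II §1.1 (neighbours of a lattice = lines of its reduction).
-/

set_option autoImplicit false

noncomputable section

open scoped Valued WithZero Matrix MatrixGroups

namespace Literature.NumberTheory.Automorphic.UnitaryLatticeTree

open Literature.NumberTheory.Automorphic Literature.NumberTheory.Automorphic.HermitianLattice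

variable {K : Type*} [Field K] [Valued K ℤᵐ⁰] {σ : K →+* K} {ϖ : K}

/-! ## §0 Small helpers -/

/-- An integral matrix does not increase the sup-bound of a vector: `(∀ j, |z j| ≤ t) → |(A z) i| ≤ t`. [cite: Serre1980Trees, II.1.1] -/
theorem v_mulVec_apply_le_of_forall_le {A : Matrix (Fin 3) (Fin 3) K} (hA : ∀ i j, Valued.v (A i j) ≤ 1) {z : Fin 3 → K} {t : ℤᵐ⁰}
    (hz : ∀ j, Valued.v (z j) ≤ t) (i : Fin 3) : Valued.v ((A.mulVec z) i) ≤ t := by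
  rw [Matrix.mulVec, dotProduct]
  refine Valuation.map_sum_le _ fun j _ => ?_
  rw [map_mul]; exact (mul_le_of_le_one_left zero_le (hA i j)).trans (hz j)

omit [Valued K ℤᵐ⁰] in
/-- The first column of a product: `(A * B) i 0 = (A *ᵥ (B · 0)) i`. [cite: Serre1980Trees, II.1.1] -/
theorem mul_apply_zero_eq_mulVec (A B : Matrix (Fin 3) (Fin 3) K) (i : Fin 3) : (A * B) i 0 = (A.mulVec fun j => B j 0) i := by
  rw [Matrix.mul_apply, Matrix.mulVec, dotProduct]

/-- Discreteness: `|z| < 1 ⇒ |z| ≤ |ϖ|`. [cite: Serre1980Trees, II.1.1] -/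
theorem v_le_of_lt_one (hϖ : Valued.v ϖ = WithZero.exp (-1 : ℤ)) {z : K} (hz : Valued.v z < 1) : Valued.v z ≤ Valued.v ϖ := by
  have hvϖ0 : Valued.v ϖ ≠ 0 := by rw [hϖ]; exact WithZero.coe_ne_zero
  have h1 : (1 : ℤᵐ⁰) = Valued.v ϖ * WithZero.exp (1 : ℤ) := by rw [hϖ, ← WithZero.exp_add]; norm_num
  rw [h1] at hz
  exact (WithZero.lt_mul_exp_iff_le hvϖ0).1 hz

/-! ## §1 The kernel test and the frame change to another neighbour -/

/-- **KERNEL TEST**: if `Y` has level `ϖ^d`, every entry off `{(0,1),(1,2),(0,2)}` is `≤ |ϖ|^{d+1}` (both shapes), `|Y₁₂| = |Y₀₁| = |ϖ|^d`, and `y ∈ 𝒪³` satisfies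
`Yy ≡ 0 (ϖ^{d+1})`, then `|y₁| < 1` and `|y₂| < 1`: residually `ȳ ∈ ker Ȳ = ⟨ē₀⟩`. [cite: Tits1979, §3.5] [cite: Serre1980Trees, II.1.1] -/
theorem v_apply_lt_one_of_forall_v_mulVec_le (hϖ : Valued.v ϖ = WithZero.exp (-1 : ℤ)) {d : ℕ} {Y : Matrix (Fin 3) (Fin 3) K}
    (hY : ∀ i j, Valued.v (Y i j) ≤ Valued.v ϖ ^ d)
    (hshape : ∀ i j : Fin 3, ¬ (i = 0 ∧ j = 1) → ¬ (i = 1 ∧ j = 2) → ¬ (i = 0 ∧ j = 2) → Valued.v (Y i j) ≤ Valued.v ϖ ^ (d + 1))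
    (h12 : Valued.v (Y 1 2) = Valued.v ϖ ^ d) (h01 : Valued.v (Y 0 1) = Valued.v ϖ ^ d)
    {y : Fin 3 → K} (hy : ∀ i, Valued.v (y i) ≤ 1) (hker : ∀ i, Valued.v ((Y.mulVec y) i) ≤ Valued.v ϖ ^ (d + 1)) :
    Valued.v (y 1) < 1 ∧ Valued.v (y 2) < 1 := by
  have hϖ0 : ϖ ≠ 0 := fun h0 => by rw [h0, map_zero] at hϖ; exact WithZero.coe_ne_zero hϖ.symm
  have hvϖ0 : Valued.v ϖ ≠ 0 := (Valuation.ne_zero_iff _).2 hϖ0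
  have hϖlt : Valued.v ϖ < 1 := by rw [hϖ, ← WithZero.exp_zero]; exact WithZero.exp_lt_exp.2 (by norm_num)
  have hne : Valued.v ϖ ^ d ≠ 0 := pow_ne_zero _ hvϖ0
  have hlt : Valued.v ϖ ^ (d + 1) < Valued.v ϖ ^ d := by
    rw [pow_succ]; exact mul_lt_of_lt_one_right (zero_lt_iff.2 hne) hϖlt
  have hsmall : ∀ {a b : K}, Valued.v a ≤ Valued.v ϖ ^ (d + 1) → Valued.v b ≤ 1 → Valued.v (a * b) ≤ Valued.v ϖ ^ (d + 1) :=
    fun {a b} ha hb => by rw [map_mul]; exact (mul_le_of_le_one_right' hb).trans ha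
  have hrow1 := hker 1
  have hrow0 := hker 0
  simp only [Matrix.mulVec, dotProduct, Fin.sum_univ_three] at hrow1 hrow0
  -- `(Yy)₁ = Y₁₀y₀ + Y₁₁y₁ + Y₁₂y₂ ≡ Y₁₂y₂`
  have h2 : Valued.v (y 2) < 1 := by
    by_contra hge
    have hy2 : Valued.v (y 2) = 1 := le_antisymm (hy 2) (not_lt.1 hge)
    have hbig : Valued.v (Y 1 2 * y 2) = Valued.v ϖ ^ d := by rw [map_mul, hy2, mul_one, h12]
    have e : Y 1 2 * y 2 = (Y 1 0 * y 0 + Y 1 1 * y 1 + Y 1 2 * y 2) - Y 1 0 * y 0 - Y 1 1 * y 1 := by ring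
    have : Valued.v (Y 1 2 * y 2) ≤ Valued.v ϖ ^ (d + 1) := by
      rw [e]
      exact (Valuation.map_sub _ _ _).trans (max_le ((Valuation.map_sub _ _ _).trans (max_le hrow1
        (hsmall (hshape 1 0 (by simp) (by simp) (by simp)) (hy 0)))) (hsmall (hshape 1 1 (by simp) (by simp) (by simp)) (hy 1)))
    exact (lt_irrefl _) ((this.trans_lt hlt).trans_eq hbig.symm)
  -- `(Yy)₀ = Y₀₀y₀ + Y₀₁y₁ + Y₀₂y₂ ≡ Y₀₁y₁` since `|y₂| ≤ |ϖ|`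
  have hy2ϖ : Valued.v (y 2) ≤ Valued.v ϖ := v_le_of_lt_one hϖ h2
  have h02y : Valued.v (Y 0 2 * y 2) ≤ Valued.v ϖ ^ (d + 1) := by
    rw [map_mul, pow_succ]; exact mul_le_mul' (hY 0 2) hy2ϖ
  refine ⟨?_, h2⟩
  by_contra hge
  have hy1 : Valued.v (y 1) = 1 := le_antisymm (hy 1) (not_lt.1 hge)
  have hbig : Valued.v (Y 0 1 * y 1) = Valued.v ϖ ^ d := by rw [map_mul, hy1, mul_one, h01]
  have e : Y 0 1 * y 1 = (Y 0 0 * y 0 + Y 0 1 * y 1 + Y 0 2 * y 2) - Y 0 0 * y 0 - Y 0 2 * y 2 := by ring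
  have : Valued.v (Y 0 1 * y 1) ≤ Valued.v ϖ ^ (d + 1) := by
    rw [e]
    exact (Valuation.map_sub _ _ _).trans (max_le ((Valuation.map_sub _ _ _).trans (max_le hrow0
      (hsmall (hshape 0 0 (by simp) (by simp) (by simp)) (hy 0)))) h02y)
  exact (lt_irrefl _) ((this.trans_lt hlt).trans_eq hbig.symm)

/-- **THE FRAME CHANGE TO ANOTHER NEIGHBOUR**: with `Y` as in the kernel test (shape + pivots, first column `≡ 0`) and `k ∈ K₀` (the neighbour `(uκ₀k)·N₁`): **the first column
of `k⁻¹Yk` is `≡ 0 (ϖ^{d+1})` iff `|k₂₀| < 1`** — iff `k·N₁ = N₁` (★ K `mapGL_N₁_eq_iff_v_apply_two_zero_lt_one`): the only neighbour whose line is a kernel line of `Ȳ` is the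
INWARD one. (`σ` valuation-preserving, for the isotropy step ★ K §4.) [cite: Tits1979, §3.5] [cite: Serre1980Trees, II.1.1] [cite: BruhatTits1972, §10] -/
theorem forall_v_conj_apply_zero_le_succ_iff (hvσ : ∀ z, Valued.v (σ z) = Valued.v z) (hϖ : Valued.v ϖ = WithZero.exp (-1 : ℤ)) {d : ℕ}
    {Y : Matrix (Fin 3) (Fin 3) K} (hY : ∀ i j, Valued.v (Y i j) ≤ Valued.v ϖ ^ d)
    (hshape : ∀ i j : Fin 3, ¬ (i = 0 ∧ j = 1) → ¬ (i = 1 ∧ j = 2) → ¬ (i = 0 ∧ j = 2) → Valued.v (Y i j) ≤ Valued.v ϖ ^ (d + 1))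
    (h12 : Valued.v (Y 1 2) = Valued.v ϖ ^ d) (h01 : Valued.v (Y 0 1) = Valued.v ϖ ^ d)
    {k : unitaryGroupOfForm σ ((StdForm.antidiagonal 3).over K)} (hk : k ∈ unitaryInt σ ((StdForm.antidiagonal 3).over K)) :
    (∀ i, Valued.v (((((k : GL (Fin 3) K)⁻¹ : GL (Fin 3) K) : Matrix (Fin 3) (Fin 3) K) * Y * ((k : GL (Fin 3) K) : Matrix (Fin 3) (Fin 3) K)) i 0) ≤ Valued.v ϖ ^ (d + 1)) ↔
      Valued.v (((k : GL (Fin 3) K) : Matrix (Fin 3) (Fin 3) K) 2 0) < 1 := by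
  have hϖ0 : ϖ ≠ 0 := fun h0 => by rw [h0, map_zero] at hϖ; exact WithZero.coe_ne_zero hϖ.symm
  have hint : ∀ i j, Valued.v (((k : GL (Fin 3) K) : Matrix (Fin 3) (Fin 3) K) i j) ≤ 1 := (mem_unitaryInt_iff.1 hk).1
  have hinv : ∀ i j, Valued.v ((((k : GL (Fin 3) K)⁻¹ : GL (Fin 3) K) : Matrix (Fin 3) (Fin 3) K) i j) ≤ 1 := (mem_unitaryInt_iff.1 hk).2
  set kM : Matrix (Fin 3) (Fin 3) K := ((k : GL (Fin 3) K) : Matrix (Fin 3) (Fin 3) K) with hkM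
  set kI : Matrix (Fin 3) (Fin 3) K := (((k : GL (Fin 3) K)⁻¹ : GL (Fin 3) K) : Matrix (Fin 3) (Fin 3) K) with hkI
  -- the first column of `k⁻¹Yk` is `k⁻¹·(Y·(k e₀))`
  have hcol : ∀ i, (kI * Y * kM) i 0 = (kI.mulVec (Y.mulVec fun j => kM j 0)) i := by
    intro i
    rw [mul_apply_zero_eq_mulVec, ← Matrix.mulVec_mulVec]
  have hcol0 : ∀ i, Valued.v (Y i 0) ≤ Valued.v ϖ ^ (d + 1) := fun i => hshape i 0 (by simp) (by simp) (by simp)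
  constructor
  · intro h
    -- `Y·(k e₀) = k·(k⁻¹Yk e₀)` is `≡ 0`, so the kernel test applies to `y = k e₀`
    have hYy : ∀ i, Valued.v ((Y.mulVec fun j => kM j 0) i) ≤ Valued.v ϖ ^ (d + 1) := by
      have e : (Y.mulVec fun j => kM j 0) = kM.mulVec (kI.mulVec (Y.mulVec fun j => kM j 0)) := by
        rw [Matrix.mulVec_mulVec, hkM, hkI, ← Units.val_mul, mul_inv_cancel, Units.val_one, Matrix.one_mulVec]
      intro i
      rw [e]
      exact v_mulVec_apply_le_of_forall_le hint (fun j => by rw [← hcol j]; exact h j) i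
    exact (v_apply_lt_one_of_forall_v_mulVec_le hϖ hY hshape h12 h01 (fun i => hint i 0) hYy).2
  · intro h20
    have h10 : Valued.v (kM 1 0) < 1 := v_apply_one_zero_lt_one_of_v_apply_two_zero_lt_one hvσ hk h20
    -- `k e₀ = k₀₀ e₀ + r`, `|r| ≤ |ϖ|`; `Y e₀ ≡ 0` and `|Y r| ≤ |ϖ|^(d+1)`
    have hYy : ∀ i, Valued.v ((Y.mulVec fun j => kM j 0) i) ≤ Valued.v ϖ ^ (d + 1) := by
      intro i
      simp only [Matrix.mulVec, dotProduct, Fin.sum_univ_three]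
      refine (Valuation.map_add _ _ _).trans (max_le ((Valuation.map_add _ _ _).trans (max_le ?_ ?_)) ?_)
      · rw [map_mul]; exact (mul_le_of_le_one_right' (hint 0 0)).trans (hcol0 i)
      · rw [map_mul, pow_succ]; exact mul_le_mul' (hY i 1) (v_le_of_lt_one hϖ h10)
      · rw [map_mul, pow_succ]; exact mul_le_mul' (hY i 2) (v_le_of_lt_one hϖ h20)
    intro i
    rw [hcol i]
    exact v_mulVec_apply_le_of_forall_le hinv hYy i

end Literature.NumberTheory.Automorphic.UnitaryLatticeTree

end
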